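import Mathlib
import HarnessLib
import Summits.Ventures.LatticeQCDFlow.Scoring.SplitChainStrongMarkov

/-!
# The strong Markov property at the FIRST REGENERATION after a given time: the time is almost
# surely finite and the path after it is a fresh split chain, independent of the past

HONEST FRAMING: exact (Metropolis-corrected) sampling algorithms for lattice gauge theory;
figures of merit are autocorrelation/cost numbers at stated couplings and volumes; no
continuum-physics claim.

Venture `LatticeQCDFlow` (cell pub-lqcd), topic `Scoring`; FANOUT row 8 (`s0-cpn-nemc`, GEN-16).
NEW WORK of the cell, not a published result; no definition is introduced.  The instance of the
random-time regeneration theorem (`Scoring/SplitChainStrongMarkov.lean`) a sampler uses first: wait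
for the next regeneration.  For the split chain of `κ(x, ·) ≥ ε ν` with `0 < ε < 1`, a time `a`, and
`T := min {t > a : coin_t = heads}`: `1{T = a + d + 1} = ∏_{i<d} 1{coin_{a+i+1} = tails} · 1{coin_{a+d+1}}`
(written inline), `P(T = a + d + 1 | past) = ε (1 − ε)^d` so `T < ∞` almost surely, and for every
bounded measurable `F` of the path up to `a` and every `H` integrable under the fresh split chain
`P̂_ν̂` (`ν̂ = ν ⊗ δ_true`): `E[F · H(θ_T X̂)] = E[F] · E_{P̂_ν̂}[H]` — as a `tsum` over `d` of the
fixed-time identities, justified by the geometric summability of `E[|F| · 1{T = a + d + 1}] · E|H|`.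
Printed counterpart NAMED ONLY: the strong Markov property of the split chain at regeneration times
(Nummelin 1978; Athreya–Ney 1978; Meyn–Tweedie 1993 §5.1; Kallenberg 2021 Thm 11.12) — nothing is
cited as a fact.

## Content (notation of `Scoring/SplitChain.lean` / `Scoring/SplitChainStrongMarkov.lean`)

* **`splitChain_strongMarkov_firstHead`** — `0 < ε < 1`, `F` bounded measurable with
  `DependsOn F (Set.Iic a)`, `H` measurable and integrable under `P̂_ν̂`:
  `E[∑' d, F · ∏_{i<d} 1{coin_{a+i+1} = tails} · 1{coin_{a+d+1}} · H(θ_{a+d+1} X̂)] = E[F] · E_{P̂_ν̂}[H]`;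
* **`splitChain_firstHead_finite`** — the case `H = 1`: `E[∑' d, F · 1{T = a + d + 1}] = E[F]`, i.e.
  the first regeneration after `a` is almost surely finite, given any weighted past;
* **`splitChain_strongMarkov_firstHead_state`** — the same for an integrable functional of the STATE
  path: after `T` the states form the `κ`-chain started afresh from `ν`:
  `E[∑' d, F · 1{T = a + d + 1} · H((X_{T+n})_n)] = E[F] · E_{P_{ν,κ}}[H]`.

Reading (value-free): "discard everything up to the next regeneration and what follows is an exact
fresh run from `ν`, independent of how the sampler was started and of what it did before" — for the
independence (flow / IMH) samplers of the cell, whose kernels satisfy `κ ≥ ε q` with `q` the proposal,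
a fresh run from a proposal draw.  NOT CLAIMED: any `ε` of a concrete sampler; the i.i.d. structure
of successive tours (separate file).
-/

noncomputable section

namespace Summit.Ventures.LatticeQCDFlow.Scoring

open MeasureTheory ProbabilityTheory Filter Finset Preorder Literature.Probability.MarkovChains
open scoped ENNReal

variable {Ω : Type*} [MeasurableSpace Ω]

section FirstRegeneration

variable {κ : Kernel Ω Ω} [IsMarkovKernel κ] {ν : Measure Ω} [IsProbabilityMeasure ν] {ε : ℝ≥0∞}
  {hmin : ∀ x {B : Set Ω}, MeasurableSet B → ε * ν B ≤ κ x B}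
  (κs : Kernel (Ω × Bool) (Ω × Bool)) [IsMarkovKernel κs]
  (μs : Measure (Ω × Bool)) [IsProbabilityMeasure μs]

/-- **THE STRONG MARKOV PROPERTY AT THE FIRST REGENERATION AFTER TIME `a`.**  `0 < ε < 1`; `F`
bounded measurable with `DependsOn F (Set.Iic a)`; `H` integrable under `P̂_ν̂`.  With
`T := min {t > a : coin_t = heads}` one has `1{T = a + d + 1} = ∏_{i<d} 1{coin_{a+i+1} = tails} ·
1{coin_{a+d+1}}`, `T < ∞` almost surely, and
`E[∑' d, F · ∏_{i<d} 1{coin_{a+i+1} = tails} · 1{coin_{a+d+1}} · H(θ_{a+d+1} X̂)] = E[F] · E_{P̂_ν̂}[H]`,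
i.e. `E[F · H(θ_T X̂)] = E[F] · E_{ν̂}[H]`: after the next regeneration the path is a fresh split chain,
independent of the past. -/
theorem splitChain_strongMarkov_firstHead (hε0 : 0 < ε) (hε : ε < 1)
    (hκs : ∀ p, κs p = (ε • ν).map (fun y : Ω => (y, true))
      + ((1 - ε) • Doeblin.residualKernel κ ν ε hmin p.1).map (fun y : Ω => (y, false)))
    (a : ℕ) {F : (ℕ → Ω × Bool) → ℝ} (hF : Measurable F) (hFd : DependsOn F (Set.Iic a))
    {CF : ℝ} (hCF : ∀ x, |F x| ≤ CF) {H : (ℕ → Ω × Bool) → ℝ} (hH : Measurable H)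
    (hHi : Integrable H (Kernel.trajMeasure (X := fun _ : ℕ => Ω × Bool)
      (ν.map (fun y : Ω => (y, true)))
      (fun n : ℕ => κs.comap (fun h : (i : ↥(Finset.Iic n)) → Ω × Bool =>
        h ⟨n, Finset.mem_Iic.2 le_rfl⟩) (measurable_pi_apply _)))) :
    ∫ x, ∑' d, F x * (∏ i ∈ Finset.range d, (if (x (a + i + 1)).2 then (0 : ℝ) else 1))
          * (if (x (a + d + 1)).2 then (1 : ℝ) else 0) * H (fun n => x (a + d + 1 + n))
        ∂(Kernel.trajMeasure (X := fun _ : ℕ => Ω × Bool) μs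
          (fun n : ℕ => κs.comap (fun h : (i : ↥(Finset.Iic n)) → Ω × Bool =>
            h ⟨n, Finset.mem_Iic.2 le_rfl⟩) (measurable_pi_apply _)))
      = (∫ x, F x ∂(Kernel.trajMeasure (X := fun _ : ℕ => Ω × Bool) μs
            (fun n : ℕ => κs.comap (fun h : (i : ↥(Finset.Iic n)) → Ω × Bool =>
              h ⟨n, Finset.mem_Iic.2 le_rfl⟩) (measurable_pi_apply _))))
        * ∫ y, H y ∂(Kernel.trajMeasure (X := fun _ : ℕ => Ω × Bool) (ν.map (fun y : Ω => (y, true)))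
          (fun n : ℕ => κs.comap (fun h : (i : ↥(Finset.Iic n)) → Ω × Bool =>
            h ⟨n, Finset.mem_Iic.2 le_rfl⟩) (measurable_pi_apply _))) := by
  set P := Kernel.trajMeasure (X := fun _ : ℕ => Ω × Bool) μs
      (fun n : ℕ => κs.comap (fun h : (i : ↥(Finset.Iic n)) → Ω × Bool =>
        h ⟨n, Finset.mem_Iic.2 le_rfl⟩) (measurable_pi_apply _)) with hP
  set Pν := Kernel.trajMeasure (X := fun _ : ℕ => Ω × Bool) (ν.map (fun y : Ω => (y, true)))
      (fun n : ℕ => κs.comap (fun h : (i : ↥(Finset.Iic n)) → Ω × Bool =>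
        h ⟨n, Finset.mem_Iic.2 le_rfl⟩) (measurable_pi_apply _)) with hPν
  have hCF0 : 0 ≤ CF :=
    (abs_nonneg _).trans (hCF fun _ => Classical.choice (nonempty_of_isProbabilityMeasure μs))
  have he0 : 0 < ε.toReal := ENNReal.toReal_pos hε0.ne' (ne_top_of_lt hε)
  have he1 : ε.toReal ≤ 1 := by
    have := (ENNReal.toReal_lt_toReal (ne_top_of_lt hε) ENNReal.one_ne_top).2 hε
    rw [ENNReal.toReal_one] at this
    exact this.le
  -- the weights `G_d = F · T_{a,d}`, functionals of the past up to `a + d`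
  have hGm : ∀ d, Measurable fun x : ℕ → Ω × Bool =>
      F x * ∏ i ∈ Finset.range d, (if (x (a + i + 1)).2 then (0 : ℝ) else 1) := fun d =>
    hF.mul (measurable_tailsProd a d)
  have hGd : ∀ d, DependsOn (fun x : ℕ → Ω × Bool =>
      F x * ∏ i ∈ Finset.range d, (if (x (a + i + 1)).2 then (0 : ℝ) else 1)) (Set.Iic (a + d)) := by
    intro d x y hxy
    show F x * _ = F y * _
    rw [hFd (fun i hi => hxy i (Set.Iic_subset_Iic.2 (Nat.le_add_right a d) hi))]
    congr 1
    exact dependsOn_tailsProd a d hxy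
  have hGC : ∀ d x, |F x * ∏ i ∈ Finset.range d, (if (x (a + i + 1)).2 then (0 : ℝ) else 1)| ≤ CF :=
    fun d x => by
    rw [abs_mul, abs_of_nonneg (tailsProd_nonneg a d x)]
    exact (mul_le_of_le_one_right (abs_nonneg _) (tailsProd_le_one a d x)).trans (hCF x)
  -- each term: `E[G_d 1{coin} H ∘ θ] = e E[G_d] E[H] = e (1 - e)^d E[F] E[H]`
  have hterm : ∀ d, ∫ x, F x * (∏ i ∈ Finset.range d, (if (x (a + i + 1)).2 then (0 : ℝ) else 1))
      * (if (x (a + d + 1)).2 then (1 : ℝ) else 0) * H (fun n => x (a + d + 1 + n)) ∂P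
      = ε.toReal * (1 - ε.toReal) ^ d * (∫ x, F x ∂P) * ∫ y, H y ∂Pν := by
    intro d
    rw [hP, splitChain_regeneration_integral_signed κs μs (κ := κ) (ν := ν) (hmin := hmin) hε hκs
      (a + d) (hGm d) (hGd d) (hGC d) hH hHi, splitChain_tailsRun κs μs (κ := κ) (ν := ν)
      (hmin := hmin) hε hκs a hF hFd hCF d, ← hP, ← hPν]
    ring
  have habs : ∀ d, ∫ x, ‖F x * (∏ i ∈ Finset.range d, (if (x (a + i + 1)).2 then (0 : ℝ) else 1))
      * (if (x (a + d + 1)).2 then (1 : ℝ) else 0) * H (fun n => x (a + d + 1 + n))‖ ∂P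
      = ε.toReal * (1 - ε.toReal) ^ d * (∫ x, |F x| ∂P) * ∫ y, |H y| ∂Pν := by
    intro d
    have hGa : Measurable fun x : ℕ → Ω × Bool =>
        |F x| * ∏ i ∈ Finset.range d, (if (x (a + i + 1)).2 then (0 : ℝ) else 1) :=
      hF.abs.mul (measurable_tailsProd a d)
    have hFad : DependsOn (fun x : ℕ → Ω × Bool => |F x|) (Set.Iic a) := fun x y hxy => by
      show |F x| = |F y|; rw [hFd hxy]
    have hGad : DependsOn (fun x : ℕ → Ω × Bool =>
        |F x| * ∏ i ∈ Finset.range d, (if (x (a + i + 1)).2 then (0 : ℝ) else 1))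
        (Set.Iic (a + d)) := by
      intro x y hxy
      show |F x| * _ = |F y| * _
      rw [hFd (fun i hi => hxy i (Set.Iic_subset_Iic.2 (Nat.le_add_right a d) hi))]
      congr 1
      exact dependsOn_tailsProd a d hxy
    have hFaC : ∀ x : ℕ → Ω × Bool, |(fun x => |F x|) x| ≤ CF := fun x => by
      show |(|F x|)| ≤ CF; rw [abs_abs]; exact hCF x
    have hGaC : ∀ x, |(|F x| * ∏ i ∈ Finset.range d, (if (x (a + i + 1)).2 then (0 : ℝ) else 1))|
        ≤ CF := fun x => by
      rw [abs_mul, abs_abs, abs_of_nonneg (tailsProd_nonneg a d x)]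
      exact (mul_le_of_le_one_right (abs_nonneg _) (tailsProd_le_one a d x)).trans (hCF x)
    have h := splitChain_regeneration_integral_signed κs μs (κ := κ) (ν := ν) (hmin := hmin) hε hκs
      (a + d) hGa hGad hGaC hH.abs hHi.abs
    rw [splitChain_tailsRun κs μs (κ := κ) (ν := ν) (hmin := hmin) hε hκs a hF.abs hFad hFaC d,
      ← hP, ← hPν] at h
    rw [show ε.toReal * (1 - ε.toReal) ^ d * (∫ x, |F x| ∂P) * ∫ y, |H y| ∂Pν
      = ε.toReal * ((1 - ε.toReal) ^ d * ∫ x, |F x| ∂P) * ∫ y, |H y| ∂Pν by ring, ← h]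
    refine integral_congr_ae (ae_of_all _ fun x => ?_)
    beta_reduce
    rw [Real.norm_eq_abs, abs_mul, abs_mul, abs_mul, abs_of_nonneg (tailsProd_nonneg a d x)]
    congr 2
    split_ifs <;> simp
  have hIt : ∀ d, Integrable (fun x : ℕ → Ω × Bool =>
      F x * (∏ i ∈ Finset.range d, (if (x (a + i + 1)).2 then (0 : ℝ) else 1))
      * (if (x (a + d + 1)).2 then (1 : ℝ) else 0) * H (fun n => x (a + d + 1 + n))) P := by
    intro d
    have hI := splitChain_integrable_head_shift κs μs (κ := κ) (ν := ν) (hmin := hmin) hε hκs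
      (a + d) hHi
    rw [← hP] at hI
    refine (hI.bdd_mul (c := CF) (hGm d).aestronglyMeasurable
      (ae_of_all _ fun x => by rw [Real.norm_eq_abs]; exact hGC d x)).congr
      (ae_of_all _ fun x => ?_)
    simp only [mul_assoc]
  have hgeom : HasSum (fun d : ℕ => ε.toReal * (1 - ε.toReal) ^ d) 1 := by
    have h := (hasSum_geometric_of_lt_one (by linarith) (by linarith : 1 - ε.toReal < 1)).mul_left
      ε.toReal
    rwa [sub_sub_cancel, mul_inv_cancel₀ he0.ne'] at h
  have hsum' : Summable fun d : ℕ => ∫ x, ‖F x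
      * (∏ i ∈ Finset.range d, (if (x (a + i + 1)).2 then (0 : ℝ) else 1))
      * (if (x (a + d + 1)).2 then (1 : ℝ) else 0) * H (fun n => x (a + d + 1 + n))‖ ∂P := by
    simp_rw [habs]
    exact ((hgeom.summable.mul_right _).mul_right _)
  rw [← integral_tsum_of_summable_integral_norm hIt hsum']
  simp_rw [hterm]
  rw [show (∫ x, F x ∂P) * ∫ y, H y ∂Pν = 1 * ((∫ x, F x ∂P) * ∫ y, H y ∂Pν) by rw [one_mul]]
  have h := (hgeom.mul_right ((∫ x, F x ∂P) * ∫ y, H y ∂Pν)).tsum_eq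
  rw [← h]
  exact tsum_congr fun d => by ring


/-- **THE FIRST REGENERATION AFTER `a` IS ALMOST SURELY FINITE** (weighted form, `H = 1`):
`E[∑' d, F · ∏_{i<d} 1{coin_{a+i+1} = tails} · 1{coin_{a+d+1}}] = E[F]`. -/
theorem splitChain_firstHead_finite (hε0 : 0 < ε) (hε : ε < 1)
    (hκs : ∀ p, κs p = (ε • ν).map (fun y : Ω => (y, true))
      + ((1 - ε) • Doeblin.residualKernel κ ν ε hmin p.1).map (fun y : Ω => (y, false)))
    (a : ℕ) {F : (ℕ → Ω × Bool) → ℝ} (hF : Measurable F) (hFd : DependsOn F (Set.Iic a))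
    {CF : ℝ} (hCF : ∀ x, |F x| ≤ CF) :
    ∫ x, ∑' d, F x * (∏ i ∈ Finset.range d, (if (x (a + i + 1)).2 then (0 : ℝ) else 1))
          * (if (x (a + d + 1)).2 then (1 : ℝ) else 0)
        ∂(Kernel.trajMeasure (X := fun _ : ℕ => Ω × Bool) μs
          (fun n : ℕ => κs.comap (fun h : (i : ↥(Finset.Iic n)) → Ω × Bool =>
            h ⟨n, Finset.mem_Iic.2 le_rfl⟩) (measurable_pi_apply _)))
      = ∫ x, F x ∂(Kernel.trajMeasure (X := fun _ : ℕ => Ω × Bool) μs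
          (fun n : ℕ => κs.comap (fun h : (i : ↥(Finset.Iic n)) → Ω × Bool =>
            h ⟨n, Finset.mem_Iic.2 le_rfl⟩) (measurable_pi_apply _))) := by
  haveI hνt : IsProbabilityMeasure (ν.map (fun y : Ω => (y, true))) :=
    Measure.isProbabilityMeasure_map (measurable_tagCoin true).aemeasurable
  have h := splitChain_strongMarkov_firstHead κs μs (κ := κ) (ν := ν) (hmin := hmin) hε0 hε hκs a
    hF hFd hCF (H := fun _ => (1 : ℝ)) measurable_const (integrable_const _)
  simpa only [mul_one, integral_const, probReal_univ, one_smul] using h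

/-- **THE STRONG MARKOV PROPERTY AT THE FIRST REGENERATION AFTER `a`, STATE-PATH FORM.**  Same
hypotheses, `H` an integrable functional of a state path under the `κ`-chain from `ν`:
`E[∑' d, F · 1{T = a + d + 1} · H((X_{a+d+1+n})_n)] = E[F] · E_{P_{ν,κ}}[H]` — after the next
regeneration the STATES form the `κ`-chain started afresh from `ν`, independent of the past. -/
theorem splitChain_strongMarkov_firstHead_state (hε0 : 0 < ε) (hε : ε < 1)
    (hκs : ∀ p, κs p = (ε • ν).map (fun y : Ω => (y, true))
      + ((1 - ε) • Doeblin.residualKernel κ ν ε hmin p.1).map (fun y : Ω => (y, false)))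
    (a : ℕ) {F : (ℕ → Ω × Bool) → ℝ} (hF : Measurable F) (hFd : DependsOn F (Set.Iic a))
    {CF : ℝ} (hCF : ∀ x, |F x| ≤ CF) {H : (ℕ → Ω) → ℝ} (hH : Measurable H)
    (hHi : Integrable H (Kernel.trajMeasure (X := fun _ : ℕ => Ω) ν
      (fun n : ℕ => κ.comap (fun h : (i : ↥(Finset.Iic n)) → Ω => h ⟨n, Finset.mem_Iic.2 le_rfl⟩)
        (measurable_pi_apply _)))) :
    ∫ x, ∑' d, F x * (∏ i ∈ Finset.range d, (if (x (a + i + 1)).2 then (0 : ℝ) else 1))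
          * (if (x (a + d + 1)).2 then (1 : ℝ) else 0) * H (fun n => (x (a + d + 1 + n)).1)
        ∂(Kernel.trajMeasure (X := fun _ : ℕ => Ω × Bool) μs
          (fun n : ℕ => κs.comap (fun h : (i : ↥(Finset.Iic n)) → Ω × Bool =>
            h ⟨n, Finset.mem_Iic.2 le_rfl⟩) (measurable_pi_apply _)))
      = (∫ x, F x ∂(Kernel.trajMeasure (X := fun _ : ℕ => Ω × Bool) μs
            (fun n : ℕ => κs.comap (fun h : (i : ↥(Finset.Iic n)) → Ω × Bool =>
              h ⟨n, Finset.mem_Iic.2 le_rfl⟩) (measurable_pi_apply _))))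
        * ∫ y, H y ∂(Kernel.trajMeasure (X := fun _ : ℕ => Ω) ν
          (fun n : ℕ => κ.comap (fun h : (i : ↥(Finset.Iic n)) → Ω => h ⟨n, Finset.mem_Iic.2 le_rfl⟩)
            (measurable_pi_apply _))) := by
  haveI hνt : IsProbabilityMeasure (ν.map (fun y : Ω => (y, true))) :=
    Measure.isProbabilityMeasure_map (measurable_tagCoin true).aemeasurable
  have hfst : Measurable (fun (x : ℕ → Ω × Bool) (n : ℕ) => (x n).1) :=
    measurable_pi_lambda _ fun n => measurable_fst.comp (measurable_pi_apply _)
  have hmap : (Kernel.trajMeasure (X := fun _ : ℕ => Ω × Bool) (ν.map (fun y : Ω => (y, true)))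
      (fun n : ℕ => κs.comap (fun h : (i : ↥(Finset.Iic n)) → Ω × Bool =>
        h ⟨n, Finset.mem_Iic.2 le_rfl⟩) (measurable_pi_apply _))).map
        (fun (x : ℕ → Ω × Bool) (n : ℕ) => (x n).1)
      = Kernel.trajMeasure (X := fun _ : ℕ => Ω) ν
        (fun n : ℕ => κ.comap (fun h : (i : ↥(Finset.Iic n)) → Ω => h ⟨n, Finset.mem_Iic.2 le_rfl⟩)
          (measurable_pi_apply _)) := by
    rw [splitChain_map_fst κs _ (κ := κ) (ν := ν) (hmin := hmin) hε hκs,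
      Measure.map_map measurable_fst (measurable_tagCoin true)]
    have : Prod.fst ∘ (fun y : Ω => (y, true)) = id := rfl
    rw [this, Measure.map_id]
  have hHi' : Integrable (H ∘ fun (x : ℕ → Ω × Bool) (n : ℕ) => (x n).1)
      (Kernel.trajMeasure (X := fun _ : ℕ => Ω × Bool) (ν.map (fun y : Ω => (y, true)))
        (fun n : ℕ => κs.comap (fun h : (i : ↥(Finset.Iic n)) → Ω × Bool =>
          h ⟨n, Finset.mem_Iic.2 le_rfl⟩) (measurable_pi_apply _))) := by
    rw [← hmap] at hHi
    exact (integrable_map_measure hHi.aestronglyMeasurable hfst.aemeasurable).1 hHi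
  have h := splitChain_strongMarkov_firstHead κs μs (κ := κ) (ν := ν) (hmin := hmin) hε0 hε hκs a
    hF hFd hCF (H := H ∘ fun (x : ℕ → Ω × Bool) (n : ℕ) => (x n).1) (hH.comp hfst) hHi'
  simp only [Function.comp_apply] at h
  rw [h, ← integral_map hfst.aemeasurable hH.aestronglyMeasurable, hmap]

end FirstRegeneration

end Summit.Ventures.LatticeQCDFlow.Scoring

end
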